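import Summits.QuantumFields.YangMills.Theorems.SwapVirialDeficitBlowUpGnomonicJointSpeeds
import Summits.QuantumFields.YangMills.Theorems.SwapVirialDeficitBlowUpGnomonicStratumBSeamFloor
import HarnessLib

/-!
# THE B-POINT SEAM FLOOR ALONG THE JOINT RAY (moving hub): `‖X′w₀ + x̂_B W′ − (W′x̂_B + w₀X′)‖²/(900L⁶) ≤ (d²/ds²)F̂(a − (sδ)·1, ε, η_B + s·ξ_B(d))|₀`,
# `W′ = A′x̂_B A₀ + Ā₀X′A₀ + Ā₀x̂_B A′ + Ā₀x̂_B A₀Z′`, `A′ = −(δ/‖a‖)·1`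
# (free-hands support of ⟨stmt-QuantumFields-24197⟩ `SwapVirialDeficit.SwapGluedStiffness`; stub (S-B) of LEAD g98's plan of record — the x₀′ seam direction INSIDE the joint
# B-form; companion of ✓`fibre_raySecond_ge_stratumB_joint` (hub∕y∕z∕F∕cross + δ²) and ✓`fibre_raySecond_ge_stratumB_seam` (fixed hub))

Same proof as ✓`fibre_raySecond_ge_stratumB_seam` with the hub unit moving, `A(s) = ν(axisPoint(a − (sδ)·1))`, `A′(0) = Ā′(0) = −(δ/‖a‖)·1` (✓`hasDerivAt_hubUnit_shift`,
✓`hasDerivAt_star_hubUnit_shift`), the 4-factor product rule ✓`hasDerivAt_slaved_movingHub`, joint smoothness ✓`contDiff_gnoDeficit_hubShift_ray`.  In coordinates (paper, STATUS 19:41Z)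
the extra terms only add `±4δ|u|²/(‖a‖(1+|u|²))` to the `i`-component, so the `x₀′`-square of ✓`fibre_raySecond_ge_stratumB_seam_coords` is unchanged along joint rays (sequel).
* ★★★ `fibre_raySecond_ge_stratumB_seam_joint (ha : a.im ≠ 0) (hre : a.re = 0) (ε) (hz) (hε) (u₁ u₂ δ d)`.

HONEST LABEL: composition of landed inequalities + one-variable calculus; stubs of ➎, ⟨24197⟩ ∕ ⟨24194⟩ ∕ ⟨24497⟩ OPEN; own crux ⟨22884⟩ OPEN (blocked-on ⟨19935⟩); the Yang–Mills
mass gap is NOT proved; no summit is proved by a line.  THEOREMS ONLY (0 `def`, 0 `sorry`), standard axioms.  Width seat ym-line-sfw-p2-w3 g66 (cell ym-idea-1, free hands),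
`--supports stmt-QuantumFields-24197`.  References: [cite: Luscher1983, §2]; [folklore].
-/

set_option autoImplicit false

noncomputable section

open MeasureTheory Quaternion
open scoped BigOperators Quaternion RealInnerProductSpace ContDiff
open Literature.MathematicalPhysics.QuantumFieldTheory hiding SU2
open Literature.MathematicalPhysics.QuantumLattice
open Literature.Analysis.Calculus (radialUnit radialUnit_def norm_radialUnit)

namespace Summit.QuantumFields.YangMills.Theorems.SwapVirialDeficit.BlowUpRing

open Summit.QuantumFields.YangMills.Theorems.FemtoTransferGap
open Summit.QuantumFields.YangMills.Theorems.FemtoTransferGap.TT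
open Summit.QuantumFields.YangMills.Theorems.FemtoTransferGap.TwoLattice.Flat (fd)
open Summit.QuantumFields.YangMills.Theorems.VirialFluxGap.RingDeficit
open Summit.QuantumFields.YangMills.Theorems.SwapVirialDeficit.SwapRing
open Summit.QuantumFields.YangMills.Theorems.SwapTwistDeficit.ToronLog (axisPoint)
open Summit.QuantumFields.YangMills.Theorems.SwapVirialDeficit.ZeroModeSigma (norm_axisUnit su2Quat_quatToSU2_eq_radialUnit axisUnit_axial)
open Summit.QuantumFields.YangMills.Theorems.SwapVirialDeficit.Gnomonic (normSq3 contDiff_radialUnit_gnoLetter contDiff_gnoDeficit_hubShift_ray contDiff_axisUnit_hubShift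
  sub_smul_one_ne_zero)
open Summit.QuantumFields.YangMills.Theorems.QuantitativeLaplace (iteratedDeriv_two_ge_of_minorant)
open Summit.QuantumFields.YangMills.Theorems.ToronValleyVolume.Lojasiewicz (fd_sq_eq_two_mul)

variable {L : ℕ} [NeZero L]

set_option maxHeartbeats 800000 in
/-- ★★★ **THE B-POINT SEAM FLOOR ALONG THE JOINT RAY** (end hub `im a ≠ 0`, `re a = 0`; `ε_z = +`, followers `+`). [cite: Luscher1983, §2] -/
theorem fibre_raySecond_ge_stratumB_seam_joint {a : ℍ} (ha : a.im ≠ 0) (hre : a.re = 0) (ε : GnoSign L) (hz : ε.2.1 = true) (hε : ε.2.2 = fun _ => true) (u₁ u₂ δ : ℝ)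
    (d : ℝ × (Fin 3 → ℝ) × (Fin 3 → ℝ) × (Fol L → Fin 3 → ℝ)) :
    ‖((Real.sqrt (1 + (u₁ ^ 2 + u₂ ^ 2)))⁻¹ • (gnoSign ε.1.1 • (gnomonicQuat ![d.1, 0, 0]).im)) * (star (radialUnit (axisPoint a)) * radialUnit (gnoLetter ε.1.1 ![0, u₁, u₂]) * radialUnit (axisPoint a)) + radialUnit (gnoLetter ε.1.1 ![0, u₁, u₂]) * ((-(δ / ‖a‖) • (1 : ℍ)) * radialUnit (gnoLetter ε.1.1 ![0, u₁, u₂]) * radialUnit (axisPoint a) + star (radialUnit (axisPoint a)) * ((Real.sqrt (1 + (u₁ ^ 2 + u₂ ^ 2)))⁻¹ • (gnoSign ε.1.1 • (gnomonicQuat ![d.1, 0, 0]).im)) * radialUnit (axisPoint a) + star (radialUnit (axisPoint a)) * radialUnit (gnoLetter ε.1.1 ![0, u₁, u₂]) * (-(δ / ‖a‖) • (1 : ℍ)) + star (radialUnit (axisPoint a)) * radialUnit (gnoLetter ε.1.1 ![0, u₁, u₂]) * radialUnit (axisPoint a) * (gnomonicQuat d.2.2.1).im) -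
        (((-(δ / ‖a‖) • (1 : ℍ)) * radialUnit (gnoLetter ε.1.1 ![0, u₁, u₂]) * radialUnit (axisPoint a) + star (radialUnit (axisPoint a)) * ((Real.sqrt (1 + (u₁ ^ 2 + u₂ ^ 2)))⁻¹ • (gnoSign ε.1.1 • (gnomonicQuat ![d.1, 0, 0]).im)) * radialUnit (axisPoint a) + star (radialUnit (axisPoint a)) * radialUnit (gnoLetter ε.1.1 ![0, u₁, u₂]) * (-(δ / ‖a‖) • (1 : ℍ)) + star (radialUnit (axisPoint a)) * radialUnit (gnoLetter ε.1.1 ![0, u₁, u₂]) * radialUnit (axisPoint a) * (gnomonicQuat d.2.2.1).im) * radialUnit (gnoLetter ε.1.1 ![0, u₁, u₂]) + (star (radialUnit (axisPoint a)) * radialUnit (gnoLetter ε.1.1 ![0, u₁, u₂]) * radialUnit (axisPoint a)) * ((Real.sqrt (1 + (u₁ ^ 2 + u₂ ^ 2)))⁻¹ • (gnoSign ε.1.1 • (gnomonicQuat ![d.1, 0, 0]).im)))‖ ^ 2 / (900 * (L : ℝ) ^ 6) ≤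
      iteratedDeriv 2 (fun s : ℝ => gnoDeficit (fun _ => false) (fun _ => 1) (a - (s * δ) • (1 : ℍ)) ε
        (((((![0, u₁, u₂] : Fin 3 → ℝ), (0 : Fin 3 → ℝ)), ((0 : Fin 3 → ℝ), (0 : Fol L → Fin 3 → ℝ))) : GnoCoord L) +
          s • ((((![d.1, 0, 0] : Fin 3 → ℝ), d.2.1), (d.2.2.1, d.2.2.2)) : GnoCoord L))) 0 := by
  have hL : (0 : ℝ) < L := by exact_mod_cast NeZero.pos L
  have ha0 : a ≠ 0 := by intro h; apply ha; rw [h]; rfl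
  -- names
  set A₀ : ℍ := radialUnit (axisPoint a) with hA₀
  set A' : ℍ := (-(δ / ‖a‖) • (1 : ℍ)) with hA'
  set X' : ℍ := ((Real.sqrt (1 + (u₁ ^ 2 + u₂ ^ 2)))⁻¹ • (gnoSign ε.1.1 • (gnomonicQuat ![d.1, 0, 0]).im)) with hX'
  set Z' : ℍ := (gnomonicQuat d.2.2.1).im with hZ'
  set η : ℝ → GnoCoord L := fun s =>
    ((((![0, u₁, u₂] : Fin 3 → ℝ), (0 : Fin 3 → ℝ)), ((0 : Fin 3 → ℝ), (0 : Fol L → Fin 3 → ℝ))) : GnoCoord L) +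
      s • ((((![d.1, 0, 0] : Fin 3 → ℝ), d.2.1), (d.2.2.1, d.2.2.2)) : GnoCoord L) with hη
  set Ah : ℝ → ℍ := fun s => radialUnit (axisPoint (a - (s * δ) • (1 : ℍ))) with hAh
  set xh : ℝ → ℍ := fun s => su2Quat (quatToSU2 (gnoLetter ε.1.1 ((![0, u₁, u₂] : Fin 3 → ℝ) + s • ![d.1, 0, 0]))) with hxh
  set zh : ℝ → ℍ := fun s => su2Quat (quatToSU2 (gnoLetter true (s • d.2.2.1))) with hzh
  set wh : ℝ → ℍ := fun s => star (Ah s) * xh s * Ah s * zh s with hwh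
  set f : ℝ → ℍ := fun s => xh s * wh s - wh s * xh s with hf
  set φ : ℝ → ℝ := fun s => gnoDeficit (fun _ => false) (fun _ => 1) (a - (s * δ) • (1 : ℍ)) ε (η s) with hφ
  have has : ∀ s : ℝ, (a - (s * δ) • (1 : ℍ)) ≠ 0 := fun s => sub_smul_one_ne_zero ha (s * δ)
  -- the letters of the ray point
  have hlet : ∀ s, (η s).1.1 = (![0, u₁, u₂] : Fin 3 → ℝ) + s • ![d.1, 0, 0] ∧ (η s).2.1 = s • d.2.2.1 := fun s =>
    ⟨rfl, by show (0 : Fin 3 → ℝ) + s • d.2.2.1 = s • d.2.2.1; rw [zero_add]⟩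
  have hxh_rad : ∀ s, xh s = radialUnit (gnoLetter ε.1.1 ((![0, u₁, u₂] : Fin 3 → ℝ) + s • ![d.1, 0, 0])) := fun s =>
    su2Quat_quatToSU2_eq_radialUnit (gnoLetter_ne_zero _ _)
  have hzh_rad : ∀ s, zh s = radialUnit (gnoLetter true (s • d.2.2.1)) := fun s => su2Quat_quatToSU2_eq_radialUnit (gnoLetter_ne_zero _ _)
  -- leaders `C₀`, `C₁` along the ray read through `su2Quat`
  have hC0 : ∀ s, su2Quat ((blowUpPoint (L := L) 1 (gnomonicPoint (a - (s * δ) • (1 : ℍ)) ε (η s))).1 0) = xh s := fun s => by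
    rw [su2Quat_gnoLeader_zero, (hlet s).1, hxh_rad]
  have hC1 : ∀ s, su2Quat ((blowUpPoint (L := L) 1 (gnomonicPoint (a - (s * δ) • (1 : ℍ)) ε (η s))).1 1) = wh s := fun s => by
    rw [su2Quat_gnoLeader_one (has s), (hlet s).1, (hlet s).2, hz]
    show _ = star (Ah s) * xh s * Ah s * zh s
    rw [hxh_rad, hzh_rad]
  -- the minorant `γ(s) = ‖f s‖²/(1800 L⁶) ≤ φ s`
  have hγle : ∀ s, ‖f s‖ ^ 2 / (1800 * (L : ℝ) ^ 6) ≤ φ s := by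
    intro s
    set q := blowUpPoint (L := L) 1 (gnomonicPoint (a - (s * δ) • (1 : ℍ)) ε (η s)) with hq
    have h := chartDeficit_ge_of_comm_far (L := L) q 0 1 (frobNorm_nonneg _) le_rfl
    have e0 : (Fin.castSucc (0 : Fin 3) : Fin 4) = 0 := rfl
    have e1 : (Fin.castSucc (1 : Fin 3) : Fin 4) = 1 := rfl
    rw [e0, e1] at h
    have hfd : frobNorm (((q.1 0 * q.1 1 : SU2) : Matrix (Fin 2) (Fin 2) ℂ) - ((q.1 1 * q.1 0 : SU2) : Matrix (Fin 2) (Fin 2) ℂ)) = fd (q.1 0 * q.1 1) (q.1 1 * q.1 0) := by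
      simp only [fd]
    have hsq : frobNorm (((q.1 0 * q.1 1 : SU2) : Matrix (Fin 2) (Fin 2) ℂ) - ((q.1 1 * q.1 0 : SU2) : Matrix (Fin 2) (Fin 2) ℂ)) ^ 2 = 2 * ‖f s‖ ^ 2 := by
      rw [hfd, fd_sq_eq_two_mul, Balaban1983to89.T4HaarSU2Translate.su2Quat_mul, Balaban1983to89.T4HaarSU2Translate.su2Quat_mul, hq, hC0, hC1]
    rw [hsq] at h
    show ‖f s‖ ^ 2 / (1800 * (L : ℝ) ^ 6) ≤ gnoDeficit (fun _ => false) (fun _ => 1) (a - (s * δ) • (1 : ℍ)) ε (η s)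
    unfold gnoDeficit
    calc ‖f s‖ ^ 2 / (1800 * (L : ℝ) ^ 6) = 2 * ‖f s‖ ^ 2 / (3600 * (L : ℝ) ^ 6) := by field_simp; ring
      _ ≤ _ := h
  -- smoothness
  have hxhd : ContDiff ℝ ∞ xh :=
    (contDiff_radialUnit_gnoLetter (n := ⊤) ε.1.1).comp (contDiff_const.add (contDiff_id.smul contDiff_const))
  have hzhd : ContDiff ℝ ∞ zh := (contDiff_radialUnit_gnoLetter (n := ⊤) true).comp (contDiff_id.smul contDiff_const)
  have hAhd : ContDiff ℝ ∞ Ah := (contDiff_axisUnit_hubShift (n := ⊤) ha).1.comp (contDiff_id.mul contDiff_const)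
  have hAhsd : ContDiff ℝ ∞ fun s => star (Ah s) := (contDiff_axisUnit_hubShift (n := ⊤) ha).2.comp (contDiff_id.mul contDiff_const)
  have hwhd : ContDiff ℝ ∞ wh := ((hAhsd.mul hxhd).mul hAhd).mul hzhd
  have hfd : ContDiff ℝ ∞ f := (hxhd.mul hwhd).sub (hwhd.mul hxhd)
  have hγd : ContDiff ℝ ∞ (fun s => ‖f s‖ ^ 2 / (1800 * (L : ℝ) ^ 6)) := (hfd.norm_sq ℝ).div_const _
  have hφd : ContDiff ℝ ∞ φ := contDiff_gnoDeficit_hubShift_ray (L := L) (fun _ => false) (fun _ => 1) ha ε δ _ _ (n := ⊤)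
  -- values at `0`
  have hx0 : xh 0 = radialUnit (gnoLetter ε.1.1 ![0, u₁, u₂]) := by rw [hxh_rad]; simp
  have hz0 : zh 0 = 1 := by rw [hzh_rad, zero_smul, gnoLetter_true_zero, radialUnit_one_quat]
  have hAh0 : Ah 0 = A₀ := by simp only [hAh, zero_mul, zero_smul, sub_zero, hA₀]
  have hw0 : wh 0 = star A₀ * xh 0 * A₀ := by simp only [hwh, hz0, mul_one, hAh0]
  -- `ŵ(0) = x̂_B*`, hence `f 0 = 0`
  have hAc := end_hub_components ha0 hre
  rw [← hA₀] at hAc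
  have hxI : (xh 0).imI = 0 := by
    rw [hx0, radialUnit_def, Quaternion.imI_smul, gnoLetter_eq]; simp [gnomonicQuat]
  have hconj := conj_end_hub hAc (xh 0)
  have hstar : star A₀ * xh 0 * A₀ = star (xh 0) := by
    ext
    · rw [hconj.1, Quaternion.re_star]
    · rw [hconj.2.1, Quaternion.imI_star, hxI, neg_zero]
    · rw [hconj.2.2.1, Quaternion.imJ_star]
    · rw [hconj.2.2.2, Quaternion.imK_star]
  have hf0 : f 0 = 0 := by
    simp only [hf, hw0, hstar]
    rw [Quaternion.self_mul_star, Quaternion.star_mul_self, sub_self]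
  have hφ0 : φ 0 = 0 := by
    simp only [hφ, hη, zero_mul, zero_smul, sub_zero, add_zero]
    exact gnoDeficit_stratumB_eq_zero ha0 hre ε hz hε u₁ u₂
  -- speeds at `0`
  have hxs : HasDerivAt xh X' 0 := by
    have h := hasDerivAt_xhatB_ray ε.1.1 u₁ u₂ d.1
    have e : xh = fun s => radialUnit (gnoLetter ε.1.1 ((![0, u₁, u₂] : Fin 3 → ℝ) + s • ![d.1, 0, 0])) := funext hxh_rad
    rw [e]; exact h
  have hzs : HasDerivAt zh Z' 0 := by
    have h := hasDerivAt_zhat_ray (d.2.2.1)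
    have e : zh = fun s => radialUnit (gnoLetter true (s • d.2.2.1)) := funext hzh_rad
    rw [e]; exact h
  have hAs : HasDerivAt Ah A' 0 := hasDerivAt_hubUnit_shift ha0 hre δ
  have hBs : HasDerivAt (fun s => star (Ah s)) A' 0 := hasDerivAt_star_hubUnit_shift ha0 hre δ
  have hws : HasDerivAt wh (A' * xh 0 * Ah 0 + star (Ah 0) * X' * Ah 0 + star (Ah 0) * xh 0 * A' + star (Ah 0) * xh 0 * Ah 0 * Z') 0 :=
    hasDerivAt_slaved_movingHub hBs hxs hAs hzs hz0
  rw [hAh0] at hws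
  have hfs : HasDerivAt f (X' * wh 0 + xh 0 * (A' * xh 0 * A₀ + star A₀ * X' * A₀ + star A₀ * xh 0 * A' + star A₀ * xh 0 * A₀ * Z') -
      ((A' * xh 0 * A₀ + star A₀ * X' * A₀ + star A₀ * xh 0 * A' + star A₀ * xh 0 * A₀ * Z') * xh 0 + wh 0 * X')) 0 :=
    (hxs.mul hws).sub (hws.mul hxs)
  have hderiv : deriv f 0 = X' * (star A₀ * xh 0 * A₀) + xh 0 * (A' * xh 0 * A₀ + star A₀ * X' * A₀ + star A₀ * xh 0 * A' + star A₀ * xh 0 * A₀ * Z') -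
      ((A' * xh 0 * A₀ + star A₀ * X' * A₀ + star A₀ * xh 0 * A' + star A₀ * xh 0 * A₀ * Z') * xh 0 + star A₀ * xh 0 * A₀ * X') := by
    rw [hfs.deriv, hw0]
  -- second derivative of the minorant
  have hγ2 : iteratedDeriv 2 (fun s => ‖f s‖ ^ 2 / (1800 * (L : ℝ) ^ 6)) 0 = 2 * ‖deriv f 0‖ ^ 2 / (1800 * (L : ℝ) ^ 6) := by
    have e : (fun s => ‖f s‖ ^ 2 / (1800 * (L : ℝ) ^ 6)) = fun s => (1800 * (L : ℝ) ^ 6)⁻¹ * ‖f s‖ ^ 2 := by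
      funext s; rw [div_eq_inv_mul]
    rw [e, iteratedDeriv_const_mul _ ((hfd.norm_sq ℝ).contDiffAt.of_le (by norm_cast)),
      iteratedDeriv_two_norm_sq_of_zero (hfd.of_le (by norm_cast)) hf0]
    rw [div_eq_inv_mul]
  -- the minorant comparison
  have key := iteratedDeriv_two_ge_of_minorant hφd hγd hγle (by
    show ‖f 0‖ ^ 2 / (1800 * (L : ℝ) ^ 6) = φ 0
    rw [hf0, hφ0, norm_zero]; simp)
  rw [hγ2, hderiv, hx0] at key
  calc _ = 2 * ‖X' * (star A₀ * radialUnit (gnoLetter ε.1.1 ![0, u₁, u₂]) * A₀) +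
        radialUnit (gnoLetter ε.1.1 ![0, u₁, u₂]) * (A' * radialUnit (gnoLetter ε.1.1 ![0, u₁, u₂]) * A₀ + star A₀ * X' * A₀ + star A₀ * radialUnit (gnoLetter ε.1.1 ![0, u₁, u₂]) * A' + star A₀ * radialUnit (gnoLetter ε.1.1 ![0, u₁, u₂]) * A₀ * Z') -
        ((A' * radialUnit (gnoLetter ε.1.1 ![0, u₁, u₂]) * A₀ + star A₀ * X' * A₀ + star A₀ * radialUnit (gnoLetter ε.1.1 ![0, u₁, u₂]) * A' + star A₀ * radialUnit (gnoLetter ε.1.1 ![0, u₁, u₂]) * A₀ * Z') * radialUnit (gnoLetter ε.1.1 ![0, u₁, u₂]) +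
          star A₀ * radialUnit (gnoLetter ε.1.1 ![0, u₁, u₂]) * A₀ * X')‖ ^ 2 / (1800 * (L : ℝ) ^ 6) := by
        field_simp; ring
    _ ≤ _ := key

end Summit.QuantumFields.YangMills.Theorems.SwapVirialDeficit.BlowUpRing

end
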